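import Summits.AnomalousDissipation.AnomalousDissipation.Theorems.MarginalStabilityChainStrainedLayerLawClockCentroidLaw
import HarnessLib

/-!
# Crux `MarginalStabilityChain.StrainedLayerLaw` (stmt-AnomalousDissipation-3007), line `FirstLemmasR2K4`
# (log-enstrophy clock + Nash roundness): the second-moment / Reynolds-stress law — tools

Support file (`--supports stmt-AnomalousDissipation-3007`; registered sub-goal `secondMoment_sliceIdentities`, the
tools of the registered sub-goal `secondMoment_law` of line `FirstLemmasR2K4`, lead c7, wave 2). For one `C²`
divergence-free `L`-periodic slice `(u, v)` with shear tails `SliceTails C k u v` and the shear far field `u → ±½`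
(`ω = ∂ₓv − ∂_yu`), over the period strip `(0, L] × ℝ`:
* `∫∫ yvω = ∫∫ uv` (the Reynolds stress as a vorticity moment): `∫∫ yv∂ₓv = 0` by periodicity, and
  `−∫∫ yv∂_yu = ∫∫ (v + y∂_yv)u = ∫∫ uv − ∫∫ yu∂ₓu = ∫∫ uv` (integration by parts across the layer with integrable
  products, `∂_yv = −∂ₓu`, and in `x` by periodicity);
* `∫∫ ω = −L` (the circulation of one period: `∫∫ ∂ₓv = 0`, `∫_y ∂_yu = 1`) and `∫∫ y∂_yω = −∫∫ ω = L`;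
* integrability of `y²ω` and of the weight `(1 + |y|)²e^{−k|y|}`, pointwise weight bookkeeping;
* the cutoff weight `ψ_R(y) = y · ψ¹_R(y)`, `ψ¹_R(y) = yσ(2 − y/R)σ(2 + y/R)` the weight of the centroid law
  (`σ` = `Real.smoothTransition`): `C¹`, `= 0` for `|y| ≥ 2R`, `|ψ_R| ≤ 4R²`, `|ψ_R′| ≤ (2 + 4C_σ)|y|`, and
  `ψ_R(y) = y²`, `ψ_R′(y) = 2y` once `R > |y|` (consumed by the main file `…ClockSecondMomentLaw.lean`).
All `[folklore]` (e.g. Majda–Bertozzi, *Vorticity and Incompressible Flow*, CUP 2002, §1.4; the Reynolds-stress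
bookkeeping of the temporal mixing layer).
-/

-- `Summit.<Summit>.<Problem>` is the tree's mandated summit-side namespace (CONVENTIONS §2); for this
-- single-conjunct summit the two coincide, so the duplicate is deliberate.
set_option linter.dupNamespace false

noncomputable section

open scoped Topology ENNReal
open Filter Set Function MeasureTheory

namespace Summit.AnomalousDissipation.AnomalousDissipation.Theorems.StrainedLayerLaw.LogEnstrophyClock

open Literature.Analysis.FluidPDE Literature.Analysis.FluidPDE.StretchedLayer
open Summit.AnomalousDissipation.AnomalousDissipation.Theses.MarginalStabilityChain
open Summit.AnomalousDissipation.AnomalousDissipation.Theorems.StrainedLayerLaw.StrainWorkSumRule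

/-! ## Slice identities: `∫∫ yvω = ∫∫ uv`, `∫∫ ω = −L`, `∫∫ y∂_yω = L`; integrability of `y²ω` -/

section SliceFacts

variable {L C k : ℝ} {f g : ℝ → ℝ → ℝ}

/-- Weight bookkeeping: `|a| ≤ A`, `|b| ≤ Be^{−k|y|}` give `|y a b| ≤ AB(1 + |y|)²e^{−k|y|}`. [folklore] -/
theorem secondMoment_bookkeeping {y a b A B k : ℝ} (ha : |a| ≤ A) (hb : |b| ≤ B * Real.exp (-k * |y|)) :
    |y * a * b| ≤ A * B * ((1 + |y|) ^ 2 * Real.exp (-k * |y|)) := by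
  have he := Real.exp_pos (-k * |y|)
  have hA : 0 ≤ A := (abs_nonneg a).trans ha
  have hB : 0 ≤ B := (mul_nonneg_iff_of_pos_right he).1 ((abs_nonneg b).trans hb)
  have hy : |y| ≤ (1 + |y|) ^ 2 := by nlinarith [abs_nonneg y]
  rw [abs_mul, abs_mul]
  calc |y| * |a| * |b| ≤ (1 + |y|) ^ 2 * A * (B * Real.exp (-k * |y|)) :=
        mul_le_mul (mul_le_mul hy ha (abs_nonneg _) (by positivity)) hb (abs_nonneg _) (by positivity)
    _ = A * B * ((1 + |y|) ^ 2 * Real.exp (-k * |y|)) := by ring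

/-- The layer weight `(1 + |y|)²e^{−k|y|}` is integrable on the period strip (`k > 0`). [folklore] -/
theorem secondMoment_integrableOn_weight (hk : 0 < k) (L : ℝ) :
    IntegrableOn (fun q : ℝ × ℝ => (1 + |q.2|) ^ 2 * Real.exp (-k * |q.2|)) (Ioc 0 L ×ˢ univ) :=
  integrableOn_strip_of_abs_le_sq_exp (C := 1) (by fun_prop) hk fun x _ y => by
    rw [abs_of_nonneg (by positivity), one_mul]

/-- The second moment density `y²ω` is integrable on the period strip under shear tails
(`|y²ω| ≤ C|y|²e^{−k|y|} ≤ C(1 + |y|)²e^{−k|y|}`). [folklore] -/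
theorem secondMoment_integrableOn_sqMoment (hk : 0 < k) (hT : SliceTails C k f g)
    (hf : ContDiff ℝ 2 (fun q : ℝ × ℝ => f q.1 q.2)) (hg : ContDiff ℝ 2 (fun q : ℝ × ℝ => g q.1 q.2)) :
    IntegrableOn (fun q : ℝ × ℝ => q.2 ^ 2 * vorticity f g q.1 q.2) (Ioc 0 L ×ˢ univ) := by
  have hC : 0 ≤ C := hT.nonneg
  have cω : Continuous fun q : ℝ × ℝ => vorticity f g q.1 q.2 := (contDiff_one_vorticity hf hg).continuous
  refine integrableOn_strip_of_abs_le_sq_exp (C := C) ((continuous_snd.pow 2).mul cω) hk fun x _ y => ?_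
  rw [abs_mul, abs_pow]
  have h1 := tails_abs_vorticity_le hT x y
  have hy : |y| ^ 2 ≤ (1 + |y|) ^ 2 := by nlinarith [abs_nonneg y]
  calc |y| ^ 2 * |vorticity f g x y| ≤ (1 + |y|) ^ 2 * (C * Real.exp (-k * |y|)) :=
        mul_le_mul hy h1 (abs_nonneg _) (by positivity)
    _ = C * ((1 + |y|) ^ 2 * Real.exp (-k * |y|)) := by ring

/-- **`∫∫ y h ∂ₓh = 0` over the period strip** for a `C²` field `h`, `L`-periodic in `x` (`0 ≤ L`), bounded, with
`|∂ₓh| ≤ Ce^{−k|y|}`: integration by parts in `x` turns the integral into its own negative. [folklore] -/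
theorem secondMoment_integral_y_mul_dX_self {h : ℝ → ℝ → ℝ} (hL : 0 ≤ L) (hk : 0 < k)
    (hh : ContDiff ℝ 2 (fun q : ℝ × ℝ => h q.1 q.2)) (hper : ∀ x y, h (x + L) y = h x y) {A : ℝ}
    (hb : ∀ x y, |h x y| ≤ A) (hd : ∀ x y, |dX h x y| ≤ C * Real.exp (-k * |y|)) :
    ∫ q in Ioc 0 L ×ˢ univ, q.2 * h q.1 q.2 * dX h q.1 q.2 = 0 := by
  have ch : Continuous fun q : ℝ × ℝ => h q.1 q.2 := hh.continuous
  have chx : Continuous fun q : ℝ × ℝ => dX h q.1 q.2 := continuous_dX (hh.of_le one_le_two)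
  have hS : MeasurableSet (Ioc (0:ℝ) L ×ˢ (univ : Set ℝ)) := measurableSet_Ioc.prod MeasurableSet.univ
  have j1 : IntegrableOn (fun q : ℝ × ℝ => q.2 * h q.1 q.2 * dX h q.1 q.2) (Ioc 0 L ×ˢ univ) :=
    integrableOn_strip_of_abs_le_sq_exp (C := A * C) ((continuous_snd.mul ch).mul chx) hk
      fun x _ y => secondMoment_bookkeeping (hb x y) (hd x y)
  have j2 : IntegrableOn (fun q : ℝ × ℝ => q.2 * dX h q.1 q.2 * h q.1 q.2) (Ioc 0 L ×ˢ univ) :=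
    j1.congr_fun (fun q _ => by ring) hS
  have e : ∫ q in Ioc 0 L ×ˢ univ, q.2 * h q.1 q.2 * dX h q.1 q.2 =
      -∫ q in Ioc 0 L ×ˢ univ, q.2 * dX h q.1 q.2 * h q.1 q.2 :=
    integral_strip_mul_dX_eq_neg hL (f := fun x y => y * h x y) (g := h) (f' := fun x y => y * dX h x y)
      (g' := dX h) (fun x y => (hasDerivAt_dX_of_contDiff hh two_ne_zero x y).const_mul y)
      (hasDerivAt_dX_of_contDiff hh two_ne_zero) (fun y => continuous_const.mul (continuous_slice_x chx y))
      (continuous_slice_x chx) (fun y => by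
        show y * h L y * h L y = y * h 0 y * h 0 y
        rw [show h L y = h 0 y by simpa using hper 0 y]) j1 j2
  have e' : ∫ q in Ioc 0 L ×ˢ univ, q.2 * dX h q.1 q.2 * h q.1 q.2 =
      ∫ q in Ioc 0 L ×ˢ univ, q.2 * h q.1 q.2 * dX h q.1 q.2 :=
    integral_congr_ae (Eventually.of_forall fun q => by simp only; ring)
  rw [e'] at e
  linarith

/-- **`∫∫ yvω = ∫∫ uv` over the period strip** for a `C²` divergence-free `L`-periodic slice with shear tails:
`∫∫ yv∂ₓv = 0` by periodicity, and `−∫∫ yv∂_yu = ∫∫ (v + y∂_yv)u = ∫∫ uv − ∫∫ yu∂ₓu = ∫∫ uv` (integration by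
parts across the layer with integrable products, `∂_yv = −∂ₓu`, and in `x` by periodicity). [folklore] -/
theorem secondMoment_integral_y_v_vorticity (hL : 0 < L) (hk : 0 < k) (hT : SliceTails C k f g)
    (hf : ContDiff ℝ 2 (fun q : ℝ × ℝ => f q.1 q.2)) (hg : ContDiff ℝ 2 (fun q : ℝ × ℝ => g q.1 q.2))
    (hdiv : ∀ x y, dX f x y + dY g x y = 0) (hfper : ∀ x y, f (x + L) y = f x y)
    (hgper : ∀ x y, g (x + L) y = g x y) :
    ∫ q in Ioc 0 L ×ˢ univ, q.2 * g q.1 q.2 * vorticity f g q.1 q.2 =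
      ∫ q in Ioc 0 L ×ˢ univ, f q.1 q.2 * g q.1 q.2 := by
  have hC : 0 ≤ C := hT.nonneg
  have hf1 : ContDiff ℝ 1 (fun q : ℝ × ℝ => f q.1 q.2) := hf.of_le one_le_two
  have hg1 : ContDiff ℝ 1 (fun q : ℝ × ℝ => g q.1 q.2) := hg.of_le one_le_two
  have cf : Continuous fun q : ℝ × ℝ => f q.1 q.2 := hf.continuous
  have cg : Continuous fun q : ℝ × ℝ => g q.1 q.2 := hg.continuous
  have cfy := continuous_dY hf1
  have cgx := continuous_dX hg1
  have cgy := continuous_dY hg1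
  have hfB : ∀ x y, |f x y| ≤ 1 + C := hT.abs_u_le hk
  have hgB : ∀ x y, |g x y| ≤ C := hT.abs_v_le_const hk
  have hS : MeasurableSet (Ioc (0:ℝ) L ×ˢ (univ : Set ℝ)) := measurableSet_Ioc.prod MeasurableSet.univ
  -- integrability of the products on the strip
  have j1 : IntegrableOn (fun q : ℝ × ℝ => q.2 * g q.1 q.2 * dX g q.1 q.2) (Ioc 0 L ×ˢ univ) :=
    integrableOn_strip_of_abs_le_sq_exp (C := C * C) ((continuous_snd.mul cg).mul cgx) hk
      fun x _ y => secondMoment_bookkeeping (hgB x y) (hT.abs_dX_v_le x y)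
  have j3 : IntegrableOn (fun q : ℝ × ℝ => q.2 * g q.1 q.2 * dY f q.1 q.2) (Ioc 0 L ×ˢ univ) :=
    integrableOn_strip_of_abs_le_sq_exp (C := C * C) ((continuous_snd.mul cg).mul cfy) hk
      fun x _ y => secondMoment_bookkeeping (hgB x y) (hT.abs_dY_u_le x y)
  have j4 : IntegrableOn (fun q : ℝ × ℝ => (1 * g q.1 q.2 + q.2 * dY g q.1 q.2) * f q.1 q.2) (Ioc 0 L ×ˢ univ) := by
    refine integrableOn_strip_of_abs_le_sq_exp (C := C * (1 + C))
      (((continuous_const.mul cg).add (continuous_snd.mul cgy)).mul cf) hk fun x _ y => ?_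
    have h1 := hT.abs_v_le x y
    have h2 := hT.abs_dY_v_le x y
    have h3 := hfB x y
    rw [abs_mul, one_mul]
    have h4 : |g x y + y * dY g x y| ≤ C * Real.exp (-k * |y|) * (1 + |y|) := by
      calc |g x y + y * dY g x y| ≤ |g x y| + |y| * |dY g x y| := by rw [← abs_mul]; exact abs_add_le _ _
        _ ≤ C * Real.exp (-k * |y|) + |y| * (C * Real.exp (-k * |y|)) :=
            add_le_add h1 (mul_le_mul_of_nonneg_left h2 (abs_nonneg _))
        _ = C * Real.exp (-k * |y|) * (1 + |y|) := by ring
    have h5 : (1:ℝ) + |y| ≤ (1 + |y|) ^ 2 := by nlinarith [abs_nonneg y]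
    calc |g x y + y * dY g x y| * |f x y| ≤ C * Real.exp (-k * |y|) * (1 + |y|) * (1 + C) :=
          mul_le_mul h4 h3 (abs_nonneg _) (by positivity)
      _ ≤ C * Real.exp (-k * |y|) * (1 + |y|) ^ 2 * (1 + C) := by gcongr
      _ = C * (1 + C) * ((1 + |y|) ^ 2 * Real.exp (-k * |y|)) := by ring
  have j5 : IntegrableOn (fun q : ℝ × ℝ => q.2 * g q.1 q.2 * f q.1 q.2) (Ioc 0 L ×ˢ univ) := by
    have h : IntegrableOn (fun q : ℝ × ℝ => q.2 * f q.1 q.2 * g q.1 q.2) (Ioc 0 L ×ˢ univ) :=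
      integrableOn_strip_of_abs_le_sq_exp (C := (1 + C) * C) ((continuous_snd.mul cf).mul cg) hk
        fun x _ y => secondMoment_bookkeeping (hfB x y) (hT.abs_v_le x y)
    exact h.congr_fun (fun q _ => by ring) hS
  have j6 : IntegrableOn (fun q : ℝ × ℝ => q.2 * f q.1 q.2 * dX f q.1 q.2) (Ioc 0 L ×ˢ univ) :=
    integrableOn_strip_of_abs_le_sq_exp (C := (1 + C) * C) ((continuous_snd.mul cf).mul (continuous_dX hf1)) hk
      fun x _ y => secondMoment_bookkeeping (hfB x y) (hT.abs_dX_u_le x y)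
  have i5 : IntegrableOn (fun q : ℝ × ℝ => f q.1 q.2 * g q.1 q.2) (Ioc 0 L ×ˢ univ) :=
    integrableOn_strip_bdd_mul_decay hk cf cg hfB hC hT.abs_v_le
  -- (i) `∫∫ yv ∂ₓv = 0`
  have hX : ∫ q in Ioc 0 L ×ˢ univ, q.2 * g q.1 q.2 * dX g q.1 q.2 = 0 :=
    secondMoment_integral_y_mul_dX_self hL.le hk hg hgper hgB hT.abs_dX_v_le
  -- (ii) `∫∫ yv ∂_yu = −∫∫ (v + y∂_yv) u`
  have e2 : ∫ q in Ioc 0 L ×ˢ univ, q.2 * g q.1 q.2 * dY f q.1 q.2 =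
      -∫ q in Ioc 0 L ×ˢ univ, (1 * g q.1 q.2 + q.2 * dY g q.1 q.2) * f q.1 q.2 :=
    integral_strip_mul_dY_eq_neg (f := fun x y => y * g x y) (g := f)
      (f' := fun x y => 1 * g x y + y * dY g x y) (g' := dY f)
      (fun x y => (hasDerivAt_id' y).fun_mul (hasDerivAt_dY_of_contDiff hg two_ne_zero x y))
      (hasDerivAt_dY_of_contDiff hf two_ne_zero) j3 j4 j5
  -- (iii) `∫∫ (v + y∂_yv) u = ∫∫ uv − ∫∫ yu ∂ₓu = ∫∫ uv`
  have e3 : ∫ q in Ioc 0 L ×ˢ univ, (1 * g q.1 q.2 + q.2 * dY g q.1 q.2) * f q.1 q.2 =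
      (∫ q in Ioc 0 L ×ˢ univ, f q.1 q.2 * g q.1 q.2) - ∫ q in Ioc 0 L ×ˢ univ, q.2 * f q.1 q.2 * dX f q.1 q.2 := by
    rw [← integral_sub i5 j6]
    refine integral_congr_ae (Eventually.of_forall fun q => ?_)
    have h := hdiv q.1 q.2
    simp only
    rw [show dY g q.1 q.2 = -dX f q.1 q.2 by linarith]
    ring
  have hX' : ∫ q in Ioc 0 L ×ˢ univ, q.2 * f q.1 q.2 * dX f q.1 q.2 = 0 :=
    secondMoment_integral_y_mul_dX_self hL.le hk hf hfper hfB hT.abs_dX_u_le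
  -- assemble `∫∫ yvω = ∫∫ yv∂ₓv − ∫∫ yv∂_yu`
  calc ∫ q in Ioc 0 L ×ˢ univ, q.2 * g q.1 q.2 * vorticity f g q.1 q.2
      = (∫ q in Ioc 0 L ×ˢ univ, q.2 * g q.1 q.2 * dX g q.1 q.2) -
          ∫ q in Ioc 0 L ×ˢ univ, q.2 * g q.1 q.2 * dY f q.1 q.2 := by
        rw [← integral_sub j1 j3]
        exact integral_congr_ae (Eventually.of_forall fun q => by simp only [StrainWorkSumRule.vorticity]; ring)
    _ = ∫ q in Ioc 0 L ×ˢ univ, f q.1 q.2 * g q.1 q.2 := by rw [hX, e2, e3, hX']; ring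

/-- **`∫∫ ω = −L` over the period strip** (the circulation of one period): `ω = ∂ₓv − ∂_yu`,
`∫_{x ∈ (0,L]} ∫_y ∂ₓv = 0` by periodicity and `∫_y ∂_yu(x, ·) = ½ − (−½) = 1` for every `x`. [folklore] -/
theorem secondMoment_integral_vorticity (hL : 0 ≤ L) (hk : 0 < k) (hT : SliceTails C k f g)
    (hf : ContDiff ℝ 2 (fun q : ℝ × ℝ => f q.1 q.2)) (hg : ContDiff ℝ 2 (fun q : ℝ × ℝ => g q.1 q.2))
    (hgper : ∀ x y, g (x + L) y = g x y) (hft : ∀ x, Tendsto (fun y => f x y) atTop (𝓝 (1 / 2)))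
    (hfb : ∀ x, Tendsto (fun y => f x y) atBot (𝓝 (-(1 / 2)))) :
    ∫ q in Ioc 0 L ×ˢ univ, vorticity f g q.1 q.2 = -L := by
  have hC : 0 ≤ C := hT.nonneg
  have hf1 : ContDiff ℝ 1 (fun q : ℝ × ℝ => f q.1 q.2) := hf.of_le one_le_two
  have hg1 : ContDiff ℝ 1 (fun q : ℝ × ℝ => g q.1 q.2) := hg.of_le one_le_two
  have iVx : IntegrableOn (fun q : ℝ × ℝ => dX g q.1 q.2) (Ioc 0 L ×ˢ univ) :=
    integrableOn_strip_of_abs_le_exp (continuous_dX hg1) hC hk fun x _ y => hT.abs_dX_v_le x y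
  have iUy : IntegrableOn (fun q : ℝ × ℝ => dY f q.1 q.2) (Ioc 0 L ×ˢ univ) :=
    integrableOn_strip_of_abs_le_exp (continuous_dY hf1) hC hk fun x _ y => hT.abs_dY_u_le x y
  have e1 : ∫ q in Ioc 0 L ×ˢ univ, dX g q.1 q.2 = 0 := by
    have h : ∫ x in Ioc 0 L, ∫ y, dX g x y = ∫ q in Ioc 0 L ×ˢ univ, dX g q.1 q.2 :=
      integral_iterated_eq_strip (F := fun q : ℝ × ℝ => dX g q.1 q.2) iVx
    rw [← h]
    exact integral_period_integral_dX_eq_zero hg1 hL hC hk hgper hT.abs_dX_v_le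
  have e2 : ∫ q in Ioc 0 L ×ˢ univ, dY f q.1 q.2 = L := by
    have h : ∫ x in Ioc 0 L, ∫ y, dY f x y = ∫ q in Ioc 0 L ×ˢ univ, dY f q.1 q.2 :=
      integral_iterated_eq_strip (F := fun q : ℝ × ℝ => dY f q.1 q.2) iUy
    have h1 : (fun x => ∫ y, dY f x y) = fun _ => (1:ℝ) :=
      funext fun x => integral_dY_shear_eq_one hf1 hk hT.abs_dY_u_le hft hfb x
    rw [← h, h1, setIntegral_const, Real.volume_real_Ioc_of_le hL, sub_zero, smul_eq_mul, mul_one]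
  calc ∫ q in Ioc 0 L ×ˢ univ, vorticity f g q.1 q.2
      = (∫ q in Ioc 0 L ×ˢ univ, dX g q.1 q.2) - ∫ q in Ioc 0 L ×ˢ univ, dY f q.1 q.2 := by
        rw [← integral_sub iVx iUy]
        exact integral_congr_ae (Eventually.of_forall fun q => rfl)
    _ = -L := by rw [e1, e2, zero_sub]

/-- **`∫∫ y ∂_yω = L` over the period strip**: integration by parts across the layer against `y`
(`yω → 0`, `|∂_yω| ≤ Ce^{−k|y|}`) gives `−∫∫ ω = L`. [folklore] -/
theorem secondMoment_integral_y_dY_vorticity (hL : 0 ≤ L) (hk : 0 < k) (hT : SliceTails C k f g)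
    (hf : ContDiff ℝ 2 (fun q : ℝ × ℝ => f q.1 q.2)) (hg : ContDiff ℝ 2 (fun q : ℝ × ℝ => g q.1 q.2))
    (hdiv : ∀ x y, dX f x y + dY g x y = 0) (hgper : ∀ x y, g (x + L) y = g x y)
    (hft : ∀ x, Tendsto (fun y => f x y) atTop (𝓝 (1 / 2)))
    (hfb : ∀ x, Tendsto (fun y => f x y) atBot (𝓝 (-(1 / 2)))) :
    ∫ q in Ioc 0 L ×ˢ univ, q.2 * dY (vorticity f g) q.1 q.2 = L := by
  have hC : 0 ≤ C := hT.nonneg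
  have hω1 : ContDiff ℝ 1 (fun q : ℝ × ℝ => vorticity f g q.1 q.2) := contDiff_one_vorticity hf hg
  have cω : Continuous fun q : ℝ × ℝ => vorticity f g q.1 q.2 := hω1.continuous
  have cωy : Continuous fun q : ℝ × ℝ => dY (vorticity f g) q.1 q.2 := continuous_dY hω1
  have i1 : IntegrableOn (fun q : ℝ × ℝ => q.2 * dY (vorticity f g) q.1 q.2) (Ioc 0 L ×ˢ univ) := by
    refine integrableOn_strip_of_abs_le_sq_exp (C := C) (continuous_snd.mul cωy) hk fun x _ y => ?_
    rw [abs_mul]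
    calc |y| * |dY (vorticity f g) x y| ≤ |y| * (C * Real.exp (-k * |y|)) :=
          mul_le_mul_of_nonneg_left (kato_abs_dY_vorticity_le hT hf hg hdiv x y) (abs_nonneg y)
      _ = C * (|y| * Real.exp (-k * |y|)) := by ring
      _ ≤ C * ((1 + |y|) ^ 2 * Real.exp (-k * |y|)) :=
          mul_le_mul_of_nonneg_left (abs_mul_exp_le_one_add_abs_sq_mul_exp k y) hC
  have i2 : IntegrableOn (fun q : ℝ × ℝ => (1:ℝ) * vorticity f g q.1 q.2) (Ioc 0 L ×ˢ univ) :=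
    integrableOn_strip_bdd_mul_decay (K := fun _ _ => (1:ℝ)) (A := 1) hk continuous_const cω
      (fun _ _ => by norm_num) hC (tails_abs_vorticity_le hT)
  have i3 := centroidLaw_integrableOn_moment (L := L) hk hT hf hg
  have e : ∫ q in Ioc 0 L ×ˢ univ, q.2 * dY (vorticity f g) q.1 q.2 =
      -∫ q in Ioc 0 L ×ˢ univ, (1:ℝ) * vorticity f g q.1 q.2 :=
    integral_strip_mul_dY_eq_neg (L := L) (f := fun _ y => y) (g := vorticity f g)
      (f' := fun _ _ => (1:ℝ)) (g' := dY (vorticity f g)) (fun _ y => hasDerivAt_id' y)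
      (hasDerivAt_dY_of_contDiff hω1 one_ne_zero) i1 i2 i3
  have e2 : ∫ q in Ioc 0 L ×ˢ univ, (1:ℝ) * vorticity f g q.1 q.2 = -L := by
    simp only [one_mul]
    exact secondMoment_integral_vorticity hL hk hT hf hg hgper hft hfb
  rw [e, e2, neg_neg]

end SliceFacts

/-! ## The weight `ψ_R(y) = y · (y σ(2 − y/R) σ(2 + y/R))` -/

section Weight

variable {R : ℝ}

/-- `ψ_R` is `C¹`. [folklore] -/
theorem secondMoment_weight_contDiff (R : ℝ) : ContDiff ℝ 1
    (fun y : ℝ => y * (y * (Real.smoothTransition (2 - y / R) * Real.smoothTransition (2 + y / R)))) :=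
  contDiff_id.mul (centroidLaw_weight_contDiff R)

/-- `ψ_R(y) = 0` for `|y| ≥ 2R` (`R > 0`). [folklore] -/
theorem secondMoment_weight_eq_zero (hR : 0 < R) {y : ℝ} (hy : 2 * R ≤ |y|) :
    y * (y * (Real.smoothTransition (2 - y / R) * Real.smoothTransition (2 + y / R))) = 0 := by
  rw [centroidLaw_weight_eq_zero hR hy, mul_zero]

/-- `|ψ_R(y)| ≤ 2R · 2R` (`R > 0`). [folklore] -/
theorem secondMoment_weight_abs_le (hR : 0 < R) (y : ℝ) :
    |y * (y * (Real.smoothTransition (2 - y / R) * Real.smoothTransition (2 + y / R)))| ≤ 2 * R * (2 * R) := by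
  by_cases hy : 2 * R ≤ |y|
  · rw [secondMoment_weight_eq_zero hR hy, abs_zero]; positivity
  · rw [abs_mul]
    exact mul_le_mul (not_le.1 hy).le (centroidLaw_weight_abs_le_two_mul hR y) (abs_nonneg _) (by positivity)

/-- `ψ_R′(y) = ψ¹_R(y) + y (ψ¹_R)′(y)` with `ψ¹_R(y) = y σ(2 − y/R) σ(2 + y/R)` (product rule). [folklore] -/
theorem secondMoment_weight_deriv (R y : ℝ) :
    deriv (fun y : ℝ => y * (y * (Real.smoothTransition (2 - y / R) * Real.smoothTransition (2 + y / R)))) y =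
      y * (Real.smoothTransition (2 - y / R) * Real.smoothTransition (2 + y / R)) +
        y * deriv (fun y : ℝ => y * (Real.smoothTransition (2 - y / R) * Real.smoothTransition (2 + y / R))) y := by
  have h := (hasDerivAt_id' y).fun_mul ((centroidLaw_weight_contDiff R).differentiable one_ne_zero y).hasDerivAt
  rw [one_mul] at h
  exact h.deriv

/-- `ψ_R′(y) = 0` for `|y| > 2R` (`R > 0`). [folklore] -/
theorem secondMoment_weight_deriv_eq_zero (hR : 0 < R) {y : ℝ} (hy : 2 * R < |y|) :
    deriv (fun y : ℝ => y * (y * (Real.smoothTransition (2 - y / R) * Real.smoothTransition (2 + y / R)))) y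
      = 0 := by
  rw [secondMoment_weight_deriv, centroidLaw_weight_eq_zero hR hy.le, centroidLaw_weight_deriv_eq_zero hR hy,
    mul_zero, add_zero]

/-- `|ψ_R′(y)| ≤ (2 + 4C_σ)|y|` (`R > 0`; `|ψ¹_R| ≤ |y|`, `|(ψ¹_R)′| ≤ 1 + 4C_σ`). [folklore] -/
theorem secondMoment_weight_deriv_abs_le (hR : 0 < R) {Cσ : ℝ} (hCσ0 : 0 ≤ Cσ)
    (hCσ : ∀ x, |deriv Real.smoothTransition x| ≤ Cσ) (y : ℝ) :
    |deriv (fun y : ℝ => y * (y * (Real.smoothTransition (2 - y / R) * Real.smoothTransition (2 + y / R)))) y|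
      ≤ (2 + 4 * Cσ) * |y| := by
  rw [secondMoment_weight_deriv]
  refine (abs_add_le _ _).trans ?_
  have h1 := centroidLaw_weight_abs_le R y
  have h2 := centroidLaw_weight_deriv_abs_le hR hCσ0 hCσ y
  calc _ ≤ |y| + |y| * (1 + 4 * Cσ) :=
        add_le_add h1 (by rw [abs_mul]; exact mul_le_mul_of_nonneg_left h2 (abs_nonneg _))
    _ = (2 + 4 * Cσ) * |y| := by ring

/-- Eventually in `R → ∞`: `ψ_R(y) = y²` and `ψ_R′(y) = 2y` (once `R > |y|`). [folklore] -/
theorem secondMoment_weight_eventually (y : ℝ) : ∀ᶠ R : ℝ in atTop,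
    y * (y * (Real.smoothTransition (2 - y / R) * Real.smoothTransition (2 + y / R))) = y ^ 2 ∧
    deriv (fun y : ℝ => y * (y * (Real.smoothTransition (2 - y / R) * Real.smoothTransition (2 + y / R)))) y
      = 2 * y := by
  filter_upwards [centroidLaw_weight_eventually y] with R hR
  refine ⟨by rw [hR.1]; ring, ?_⟩
  rw [secondMoment_weight_deriv, hR.1, hR.2]
  ring

end Weight

/-! ## The registered tools sub-goal -/

/-- **Tools for `secondMoment_law` (registered sub-goal `secondMoment_sliceIdentities`).** For a `C²` divergence-free
`L`-periodic slice with shear tails `SliceTails C k` (`L, k > 0`) and the shear far field `u(x, ·) → ±½`, over the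
period strip: `∫∫ yvω = ∫∫ uv`, `∫∫ ω = −L`, `∫∫ y∂_yω = L`. [folklore] -/
theorem secondMoment_sliceIdentities : ∀ (L C k : ℝ) (f g : ℝ → ℝ → ℝ), 0 < L → 0 < k → SliceTails C k f g →
    ContDiff ℝ 2 (fun q : ℝ × ℝ => f q.1 q.2) → ContDiff ℝ 2 (fun q : ℝ × ℝ => g q.1 q.2) →
    (∀ x y, dX f x y + dY g x y = 0) → (∀ x y, f (x + L) y = f x y) → (∀ x y, g (x + L) y = g x y) →
    (∀ x, Tendsto (fun y => f x y) atTop (𝓝 (1 / 2))) → (∀ x, Tendsto (fun y => f x y) atBot (𝓝 (-(1 / 2)))) →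
      (∫ q in Ioc 0 L ×ˢ univ, q.2 * g q.1 q.2 * vorticity f g q.1 q.2 =
          ∫ q in Ioc 0 L ×ˢ univ, f q.1 q.2 * g q.1 q.2) ∧
      (∫ q in Ioc 0 L ×ˢ univ, vorticity f g q.1 q.2 = -L) ∧
      (∫ q in Ioc 0 L ×ˢ univ, q.2 * dY (vorticity f g) q.1 q.2 = L) :=
  fun _ _ _ _ _ hL hk hT hf hg hdiv hfper hgper hft hfb =>
    ⟨secondMoment_integral_y_v_vorticity hL hk hT hf hg hdiv hfper hgper,
      secondMoment_integral_vorticity hL.le hk hT hf hg hgper hft hfb,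
      secondMoment_integral_y_dY_vorticity hL.le hk hT hf hg hdiv hgper hft hfb⟩

end Summit.AnomalousDissipation.AnomalousDissipation.Theorems.StrainedLayerLaw.LogEnstrophyClock

end
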